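import Summits.KontsevichZagierPeriods.KontsevichZagierPeriods.Theses.FurushoPentagon
import Summits.KontsevichZagierPeriods.KontsevichZagierPeriods.Theses.LiftingCriteria
import Summits.KontsevichZagierPeriods.KontsevichZagierPeriods.Theorems.FurushoPentagonSectorToKernelResolvedRing
import Summits.KontsevichZagierPeriods.KontsevichZagierPeriods.Theorems.HurwitzMicroSectorsNormalFormPrinciplePiBoxTower
import Literature.NumberTheory.Transcendental.KZCubicalCalculus
import Literature.NumberTheory.Transcendental.KZProduct
import Literature.NumberTheory.Transcendental.KZProductIdeal
import Literature.NumberTheory.Transcendental.KZRulesAssociator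

/-!
# `ReducedPeriodRing` (stmt-KontsevichZagierPeriods-3929), line `ayoub-stokes-cartier`: proof skeleton v1

Crux (route FurushoPentagon, rank 3): `∀ c : KZ.FormalRep, c * c ∈ KZ.relations → c ∈ KZ.relations`
(the formal period ring `P = FormalRep ⧸ relations` of the Kontsevich–Zagier calculus is reduced).
Strategist's line (crux-strategist unit `cstrat-stmt-KontsevichZagierPeriods-3929-p1`, wall-breaker on
the exhausted chain). It is the `[π]`-LOCALISATION cut

  crux ⟸ NilIsPiTorsion (square-zero classes are `[π]`-power torsion) ∧ PiCancellation (item 0540),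

with `NilIsPiTorsion` — the TRANSCENDENCE-FREE half — cut along the abstract transfer
`Theorems/ReducedPeriodRing/Negative/LineLoadBearing.lean: nil_torsion_of_transfer` with the target
ring PINNED to Ayoub's compact presentation of effective periods in REAL form: tame cube classes
(`ReducedPeriodRing.cubicalGens`: domain `[0,1]ⁿ`, integrand analytic near the cube) modulo
`ayoubIdeal := ⟨KZ.cubicalLinGens ∪ KZ.cubicalStokesGens⟩` (ℚ-linearity of the integrand and
Newton–Leibniz with algebraic-analytic primitives = Ayoub 2014 Def. 10, relation
`∂f/∂zᵢ − f|_{zᵢ=1} + f|_{zᵢ=0}`), localised at the arctangent kernel `κ = [[0,1], du/((1−u)²+u²)]`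
(value `π/2`; `[π] ≡ 2[κ]` is the LANDED `stub_piCalibration` of route HurwitzMicroSectors).

Registered stubs (4):
* S1 `stub_cubeNashNormalForm` — item stmt-KontsevichZagierPeriods-3574 of route LiftingCriteria BY
  NAME (cube-Nash normal form); cube resolution of every class follows by the landed
  `SectorToKernel.cubeResolution_of_cubeNashNormalForm`. Theorem-grade (Hironaka / rectilinearisation).
* S2 `stub_kernelControlModPi` — COMPARISON KZ ⇒ Ayoub modulo `κ`-powers: a `ℤ`-combination of tame
  cube classes that is a KZ relation becomes, after finitely many left multiplications by `[κ]`, an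
  element of `ayoubIdeal`. Theorem-type, XL: a sound Nori/Kontsevich symbol on the four moves
  (`KZ.NoriSymbolData`, Ψ2; HMS 2017 Ch. 12 in substance) + Ayoub 2014 Prop. 11 (injectivity of
  `𝒫^eff_Ayoub[1/2πi] → 𝒫_formal`) + real/complex descent. HARDEST.
* S3 `stub_ayoubLocalisedReduced` — Ayoub's real effective ring localised at `κ` has no square-zero
  elements, in the exact form the composition consumes (`[κ]^N (a*a) ∈ ayoubIdeal ⇒ [κ]^M a ∈
  ayoubIdeal`). Named-fact-type + one calibration: Ayoub 2014 Prop. 11 + Nori's torsor theorem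
  (HMS 2017 §13.1) + Cartier (Milne, Algebraic Groups, Thm. 3.23) + the Ayoub-side calibration
  `κ² ∼ −(2πi)²/16` + real descent.
* S4 `stub_piCancellation` — `KZ.PiCancellation`, = item stmt-KontsevichZagierPeriods-0540 (closed-term
  form; the pinned form is equivalent given `exists_pinnedProduct`). Open, period-conjecture type; all
  transcendence-type weight of the crux sits here.

Proved here (no `sorry` outside the stubs): `ayoubIdeal_le_relations` (soundness, from the Literature
theorems `KZ.cubicalLinGens_subset_relations`, `KZ.cubicalStokesGens_subset_relations`);
`exists_isKappa`, `kappa_mem_cubicalGens`; the transfer `nilIsPiTorsion_of : NilIsPiTorsion` (closed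
form, `KZ.of KZ.piRep * ·`) from S1–S3; and the composition `ReducedPeriodRing_of` concluding the crux
BY NAME from `nilIsPiTorsion_of` and S4.

Disproof used: `Cruxes/ReducedPeriodRing/Disproof.lean` §2 `reducedPeriodRing_false_without_sq` (the
square is used: S2 is applied to `a * a`, S3 extracts the root); §6 `multiplicative_certificate_vanishes`
(no multiplicative invariant can DETECT a nilpotent — this line uses the multiplicative symbol only to
KILL nilpotents after localisation, with kernel control S2 as the separate non-tautological input);
§9b drop-one models `transfer_needs_surjective / _kernel_control / _localised_reduced / _regular` =
S1 / S2 / S3 / S4 respectively, each load-bearing; TRIAGE-r1-2 `Costume.lean` (target ring must be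
PINNED: it is, `ayoubIdeal` is Ayoub's printed presentation, not an ∃R).
-/

noncomputable section

set_option linter.dupNamespace false

namespace Summit.KontsevichZagierPeriods.KontsevichZagierPeriods.Cruxes.ReducedPeriodRing.AyoubStokesCartier

open Set MeasureTheory
open Literature.NumberTheory.Transcendental
open Literature.NumberTheory.Transcendental.KZ hiding cubicalSpan
open Summit.KontsevichZagierPeriods.KontsevichZagierPeriods.Theses.FurushoPentagon
open Summit.KontsevichZagierPeriods.FurushoPentagon.ReducedPeriodRing (unitCube cubicalGens cubicalSpan)
open Summit.KontsevichZagierPeriods.FurushoPentagon.SectorToKernel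
  (cubeResolution_of_cubeNashNormalForm leaves_cubeNormalForm resolvedRing_mul_mem_cubicalSpan
    leaves_unitCube_eq_cube)
open Summit.KontsevichZagierPeriods.HurwitzMicroSectors.NormalFormPrinciple.PiBox
  (exists_kappa stub_piCalibration)

/-! ## The pinned target: Ayoub's presentation in real form, and the localising kernel `κ` -/

/-- **Ayoub's relation module (real form)**: the subgroup of `KZ.FormalRep` generated by
ℚ-LINEARITY of the integrand on a cube (`KZ.cubicalLinGens`: `[r] − [r₁] − [r₂]`, `f = f₁ + f₂` on
`[0,1]ⁿ`) and the STOKES relations (`KZ.cubicalStokesGens`: `[[0,1]ⁿ⁺¹, ∂ₜF] − [[0,1]ⁿ, F(·,1) − F(·,0)]`,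
`F` analytic near the cube and `ℚ`-semialgebraic = algebraic over `ℚ(z)`). No change-of-variables and
no subdivision generators: this is exactly Ayoub's presentation `𝒪_alg(𝔻̄^∞) ⧸ ⟨∂f/∂zᵢ − f|_{zᵢ=1} +
f|_{zᵢ=0}⟩` (for which Prop. 11 is in print), not the tree's larger cubical sub-calculus
`KZ.cubicalSpan`. [cite: Ayoub2014, Def. 10] -/
def ayoubIdeal : AddSubgroup FormalRep :=
  AddSubgroup.closure (KZ.cubicalLinGens ∪ KZ.cubicalStokesGens)

/-- **Soundness of Ayoub's presentation inside the rules**: every generator is a KZ move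
(`KZ.cubicalLinGens_subset_relations`, `KZ.cubicalStokesGens_subset_relations`, Literature
`KZCubicalCalculus.lean`), so `ayoubIdeal ≤ KZ.relations`. [cite: Ayoub2014, Def. 10] -/
theorem ayoubIdeal_le_relations : ayoubIdeal ≤ relations := by
  refine (AddSubgroup.closure_le _).mpr ?_
  rintro x (hx | hx)
  · exact KZ.cubicalLinGens_subset_relations hx
  · exact KZ.cubicalStokesGens_subset_relations hx

/-- The localising element: the bounded arctangent kernel `κ = [[0,1], du/((1−u)²+u²)]`
(`∫₀¹ du/((1−u)²+u²) = π/2`), pinned by domain and integrand (the remaining fields of `IntegralRep`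
are Props, so `κ` is unique). `[π] − 2•[κ] ∈ KZ.relations` is the landed `stub_piCalibration` of route
HurwitzMicroSectors. [cite: KontsevichZagier2001, §1.1] -/
def IsKappa (κ : IntegralRep 1) : Prop :=
  κ.domain = {x | x 0 ∈ Set.Icc (0:ℝ) 1} ∧ κ.integrand = (fun x => 1 / ((1 - x 0) ^ 2 + x 0 ^ 2))

/-- The kernel `κ` exists (landed `exists_kappa`). [folklore] -/
theorem exists_isKappa : ∃ κ : IntegralRep 1, IsKappa κ := exists_kappa

/-- `{x | x 0 ∈ [0,1]} = [0,1]¹`. [folklore] -/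
theorem setOf_Icc_eq_unitCube : {x : Fin 1 → ℝ | x 0 ∈ Set.Icc (0:ℝ) 1} = unitCube 1 := by
  ext x
  simp only [mem_setOf_eq, Set.mem_Icc, Summit.KontsevichZagierPeriods.FurushoPentagon.ReducedPeriodRing.mem_unitCube,
    Fin.forall_fin_one]

/-- The integrand of `κ` is real analytic everywhere (its denominator `(1−u)²+u² ≥ 1/2`). [folklore] -/
theorem analyticOnNhd_kappaIntegrand (S : Set (Fin 1 → ℝ)) :
    AnalyticOnNhd ℝ (fun x : Fin 1 → ℝ => 1 / ((1 - x 0) ^ 2 + x 0 ^ 2)) S := by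
  have h0 : AnalyticOnNhd ℝ (fun x : Fin 1 → ℝ => x 0) Set.univ :=
    (ContinuousLinearMap.proj (R := ℝ) (φ := fun _ : Fin 1 => ℝ) 0).analyticOnNhd _
  have hden : AnalyticOnNhd ℝ (fun x : Fin 1 → ℝ => (1 - x 0) ^ 2 + x 0 ^ 2) Set.univ :=
    ((analyticOnNhd_const.sub h0).pow 2).add (h0.pow 2)
  have hpos : ∀ x : Fin 1 → ℝ, (1 - x 0) ^ 2 + x 0 ^ 2 ≠ 0 := fun x => by
    have : 0 < (1 - x 0) ^ 2 + x 0 ^ 2 := by nlinarith [sq_nonneg (x 0 - 1 / 2)]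
    exact this.ne'
  exact (analyticOnNhd_const.div hden fun x _ => hpos x).mono (Set.subset_univ S)

/-- `[κ]` is a tame cube class. [folklore] -/
theorem kappa_mem_cubicalGens {κ : IntegralRep 1} (hκ : IsKappa κ) : of κ ∈ cubicalGens := by
  refine ⟨1, κ, ?_, ?_, rfl⟩
  · rw [hκ.1, setOf_Icc_eq_unitCube]
  · rw [hκ.2]; exact analyticOnNhd_kappaIntegrand _

/-! ## Registered stubs (open) -/

/-- **S1 (cube-Nash normal form) = item stmt-KontsevichZagierPeriods-3574 of route LiftingCriteria, by
name.** Every difference of KZ-rational representations is KZ-equivalent to a `ℤ`-combination of tame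
cube classes (semialgebraic triangulation + embedded resolution of the boundary singularities + ramified
substitutions, all realised by moves). Gives cube resolution of EVERY class through the landed
`SectorToKernel.cubeResolution_of_cubeNashNormalForm` (Viu-Sos reduction to rational data first).
Theorem-grade (Hironaka / Bierstone–Milman strength), shared with the SectorToKernel line
`effective-cube-surjection` (its S1). [cite: HuberMullerStachPeriods2017, §12.1; Ayoub2014, Rem. 12] -/
theorem stub_cubeNashNormalForm :
    Summit.KontsevichZagierPeriods.KontsevichZagierPeriods.Theses.LiftingCriteria.CubeNashNormalForm := by
  sorry

/-- **S2 (kernel control modulo `κ`-powers; the COMPARISON KZ ⇒ Ayoub; hardest).** If a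
`ℤ`-combination `a` of tame cube classes is a KZ relation, then `[κ]^N ⋆ a` (left-nested) lies in
Ayoub's relation module for some `N`: a cube class killed by the four moves of Kontsevich–Zagier is
killed by LINEARITY + STOKES alone once enough factors `∫₀¹du/((1−u)²+u²)` are prefixed. Route to a
proof (all summit-free): (i) a SOUND additive symbol Ψ from `KZ.FormalRep` to the formal period algebra
of Nori/Kontsevich killing the four moves (Ψ2 of `KZ.NoriSymbolData`; HMS 2017 Ch. 12 "in substance",
not a theorem in print for semialgebraic data), MULTIPLICATIVE on Fubini products; (ii) on tame cube
classes Ψ agrees with Ayoub's comparison map, which is INJECTIVE after inverting `2πi` (Ayoub 2014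
Prop. 11: `𝒫^eff_Ayoub[(2πi)⁻¹] ≅ 𝒫`); (iii) calibration `κ ⋆ κ ≡ −(2πi)²/16 · 𝟙` on Ayoub's side and
real descent (complex conjugation acts on both presentations). Why it might fail as typed: only if
Ψ-soundness fails for a semialgebraic (non-algebraic Nash) change of variables — i.e. a KZ move that is
not a motivic relation — or if the real descent loses a 2-torsion; either would be a discovery.
[cite: Ayoub2014, Prop. 11; HuberMullerStachPeriods2017, §12.1–13.1] -/
theorem stub_kernelControlModPi :
    ∀ κ : IntegralRep 1, IsKappa κ → ∀ a : FormalRep, a ∈ cubicalSpan → a ∈ relations →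
      ∃ N : ℕ, (fun x => of κ * x)^[N] a ∈ ayoubIdeal := by
  sorry

/-- **S3 (Ayoub's real effective ring, localised at `κ`, has no square-zero elements), in the exact
form the composition consumes** (no commutativity/associativity of `⋆` modulo `ayoubIdeal` is
presupposed): for a `ℤ`-combination `a` of tame cube classes, if `[κ]^N ⋆ (a ⋆ a) ∈ ayoubIdeal` then
`[κ]^M ⋆ a ∈ ayoubIdeal` for some `M`. Source: Ayoub 2014 Prop. 11 identifies `𝒫^eff_Ayoub[(2πi)⁻¹]`
with the formal period ring of Kontsevich/Nori, the coordinate ring of the TORSOR of tensor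
isomorphisms `H_dR ≅ H_B` under the motivic Galois group (Nori; HMS 2017 Thm. 13.1.4 / §13.2), a
pro-algebraic group in characteristic `0`, hence smooth (Cartier; Milne Thm. 3.23) — so the torsor ring
is REDUCED and nilpotents of the effective ring die after inverting `2πi`; plus the calibration
`κ ⋆ κ ≡ −(2πi)²/16` inside Ayoub's presentation and real descent. The motivic analogue is thus a
THEOREM; what is not in the tree is the formalisation (named facts to be filed: Ayoub Prop. 11, Nori's
torsor theorem, Cartier). Modulo S1 + S2 this stub is equivalent to `NilIsPiTorsion` (surjective
transfer with controlled kernel: `A[1/κ] ≅ P[1/π]`) — the content is the PINNING of `A` to a presentation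
for which Prop. 11 is printed (TRIAGE-r1-1 G1 / r1-2 Costume.lean). [cite: Ayoub2014, Prop. 11;
HuberMullerStachPeriods2017, §13.1–13.2] -/
theorem stub_ayoubLocalisedReduced :
    ∀ κ : IntegralRep 1, IsKappa κ → ∀ a : FormalRep, a ∈ cubicalSpan → ∀ N : ℕ,
      (fun x => of κ * x)^[N] (a * a) ∈ ayoubIdeal → ∃ M : ℕ, (fun x => of κ * x)^[M] a ∈ ayoubIdeal := by
  sorry

/-- **S4 (`π`-cancellation) = item stmt-KontsevichZagierPeriods-0540** (closed-term form
`[π] ⋆ c ∈ relations → c ∈ relations`; the pinned `∀ P` form of the item is equivalent given the landed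
`exists_pinnedProduct`). Open, period-conjecture type (motivic shadow: Huber–Wüstholz 2022 App. A.4);
shared with routes AyoubSpecialisation / KatzTower / HurwitzMicroSectors and the BetaCancellation line
of TerasomaMultiplication; ALL transcendence-type weight of the crux sits here (crux ⇏ 0540, 0540 ⇏ crux
abstractly). [cite: HuberWustholz2022, App. A.4; Ayoub2014, Def. 6] -/
theorem stub_piCancellation : PiCancellation := by
  sorry

/-! ## The transfer (proved): S1 ∧ S2 ∧ S3 ⇒ square-zero classes are `[π]`-power torsion -/

/-- Cube resolution of every formal combination, from S1. [cite: Ayoub2014, Rem. 12] -/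
theorem resolved_of_S1 (c : FormalRep) : ∃ a ∈ cubicalSpan, c - a ∈ relations :=
  leaves_cubeNormalForm (cubeResolution_of_cubeNashNormalForm stub_cubeNashNormalForm) c

/-- Left multiplication by `[κ]` preserves `cubicalSpan` (products of tame cube classes are tame cube
classes, `SectorToKernel.resolvedRing_mul_mem_cubicalSpan`). [folklore] -/
theorem kmul_iterate_mem_cubicalSpan {κ : IntegralRep 1} (hκ : IsKappa κ) (N : ℕ) {a : FormalRep}
    (ha : a ∈ cubicalSpan) : (fun x => of κ * x)^[N] a ∈ cubicalSpan := by
  induction N with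
  | zero => simpa using ha
  | succ N ih =>
    rw [Function.iterate_succ_apply']
    exact resolvedRing_mul_mem_cubicalSpan (AddSubgroup.subset_closure (kappa_mem_cubicalGens hκ)) ih

/-- Iterates of a left multiplication commute with doubling. [folklore] -/
theorem iterate_mul_two_nsmul (g : FormalRep) (N : ℕ) (z : FormalRep) :
    (fun x => g * x)^[N] ((2:ℕ) • z) = (2:ℕ) • (fun x => g * x)^[N] z := by
  induction N generalizing z with
  | zero => rfl
  | succ N ih =>
    rw [Function.iterate_succ_apply, Function.iterate_succ_apply, ← ih]
    congr 1
    simp only [two_nsmul, mul_add]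

/-- **`[π]`-iterates versus `[κ]`-iterates**: if `x ≡ y` and `[κ]^N ⋆ y` is a relation then
`[π]^N ⋆ x` is a relation (`[π] ≡ 2[κ]`, relations are a two-sided ideal). [cite: KontsevichZagier2001, §1.1] -/
theorem piIterate_mem_relations_of_kappaIterate {κ : IntegralRep 1} (hκ : IsKappa κ) :
    ∀ (N : ℕ) (x y : FormalRep), x - y ∈ relations → (fun z => of κ * z)^[N] y ∈ relations →
      (fun z => of piRep * z)^[N] x ∈ relations := by
  have hπκ : of piRep - (2:ℕ) • of κ ∈ relations := stub_piCalibration κ hκ.1 hκ.2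
  intro N
  induction N with
  | zero =>
    intro x y hxy hy
    have := relations.add_mem hxy hy
    simpa using this
  | succ N ih =>
    intro x y hxy hy
    rw [Function.iterate_succ_apply]
    rw [Function.iterate_succ_apply] at hy
    -- `[π] x ≡ 2 • [κ] y`
    refine ih (of piRep * x) ((2:ℕ) • (of κ * y)) ?_ ?_
    · have h1 : of piRep * x - of piRep * y ∈ relations := by
        rw [← mul_sub]; exact mul_mem_relations_left_holds _ _ hxy
      have h2 : of piRep * y - ((2:ℕ) • of κ) * y ∈ relations := by
        rw [← sub_mul]; exact mul_mem_relations_right_holds _ _ hπκ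
      have h3 : ((2:ℕ) • of κ) * y = (2:ℕ) • (of κ * y) := smul_mul_assoc _ _ _
      have := relations.add_mem h1 h2
      rw [h3] at this
      simpa using this
    · rw [iterate_mul_two_nsmul]
      exact relations.nsmul_mem hy 2

/-- **The transfer**: S1 ∧ S2 ∧ S3 ⇒ every square-zero class of the KZ calculus is `[π]`-power torsion
modulo relations (closed-term `NilIsPiTorsion`, the shape of `KZ.PiLocalKernel`): resolve `c ≡ a`
(S1), so `a ⋆ a ≡ c ⋆ c` is a KZ relation among tame cube classes; kernel control (S2) puts
`[κ]^N ⋆ (a ⋆ a)` in Ayoub's module; localised reducedness (S3) gives `[κ]^M ⋆ a ∈ ayoubIdeal ⊆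
relations`; transport back along `c ≡ a`, `[π] ≡ 2[κ]`. [cite: Ayoub2014, Prop. 11] -/
theorem nilIsPiTorsion_of :
    ∀ c : FormalRep, c * c ∈ relations → ∃ N : ℕ, (fun x => of piRep * x)^[N] c ∈ relations := by
  intro c hc
  obtain ⟨κ, hκ⟩ := exists_isKappa
  obtain ⟨a, ha, hca⟩ := resolved_of_S1 c
  have haa : a * a ∈ relations := by
    have h1 : c * c - a * a ∈ relations := mul_sub_mul_mem_relations hca hca
    have := relations.sub_mem hc h1
    simpa using this
  obtain ⟨N, hN⟩ :=
    stub_kernelControlModPi κ hκ (a * a) (resolvedRing_mul_mem_cubicalSpan ha ha) haa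
  obtain ⟨M, hM⟩ := stub_ayoubLocalisedReduced κ hκ a ha N hN
  exact ⟨M, piIterate_mem_relations_of_kappaIterate hκ M c a hca (ayoubIdeal_le_relations hM)⟩

/-! ## Composition: the crux by name -/

/-- **The line's deciding step**: S1–S3 (through `nilIsPiTorsion_of`) and S4 (= item 0540) prove the
crux `ReducedPeriodRing` BY NAME — peel the `N` factors `[π]` one at a time. [cite: KontsevichZagier2001, §4.1] -/
theorem ReducedPeriodRing_of :
    Summit.KontsevichZagierPeriods.KontsevichZagierPeriods.Theses.FurushoPentagon.ReducedPeriodRing := by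
  intro c hc
  obtain ⟨N, hN⟩ := nilIsPiTorsion_of c hc
  induction N with
  | zero => simpa using hN
  | succ N ih =>
    exact ih (stub_piCancellation _ (by simpa only [Function.iterate_succ_apply'] using hN))

end Summit.KontsevichZagierPeriods.KontsevichZagierPeriods.Cruxes.ReducedPeriodRing.AyoubStokesCartier
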